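import Mathlib
import Literature.AlgebraicGeometry.Resolution.CobordantGame
import Literature.AlgebraicGeometry.Resolution.CobordantChartCoefficients
import Literature.AlgebraicGeometry.Resolution.CobordantChartPlaneSlice
import Literature.AlgebraicGeometry.Resolution.AxisPolyhedron
import Summits.ResolutionOfSingularities.ResolutionOfSingularities.Theorems.WeightedInvariantLocalWeightedDropTangentConeCut
import Summits.ResolutionOfSingularities.ResolutionOfSingularities.Theorems.WeightedInvariantLocalWeightedDropAxisWeightedMoveLevel
import Summits.ResolutionOfSingularities.ResolutionOfSingularities.Theorems.WeightedInvariantLocalWeightedDropAxisWeightedMoveCone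
import Summits.ResolutionOfSingularities.ResolutionOfSingularities.Theorems.WeightedInvariantLocalWeightedDropAxisWeightedMoveTranslate
import Summits.ResolutionOfSingularities.ResolutionOfSingularities.Theorems.WeightedInvariantLocalWeightedDropAxisWeightedMoveSlice
import Summits.ResolutionOfSingularities.ResolutionOfSingularities.Theorems.WeightedInvariantLocalWeightedDropAxisWeightedMoveRotate

/-!
# `WeightedInvariant.LocalWeightedDrop`, line `hasse-ridge-face-selection`: the weighted move from a prepared axis germ (B2)

Crux item stmt-ResolutionOfSingularities-8899 (route `ResolutionOfSingularities/WeightedInvariant`), skeleton v18 of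
the line `hasse-ridge-face-selection`, stub `stub_axisWeightedMove` (B2), PROVED here (statement verbatim from the
ledger registration), assembling parts 1–4 (`…AxisWeightedMoveCone/Translate/Slice/Rotate`) and the registered helper
`stub_axisWeightedMoveLevel`.

**Statement.**  `k` algebraically closed of characteristic `p`; `g ∈ k[[x'₁, …, x'ₙ, z]]` singular of order `d`, with
`AxisCone` (degree-`d` form `F` free of `z`), `TrivialApexX` (no non-zero `(u, 0)` leaves `F` invariant),
`¬ InAxisIdeal` (some monomial `x'^a z^e`, `|a| < d`) and `PreparedAxis` (no non-zero vector solves the vertex at any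
integer level).  Given that the singular germs of order `< d` are won and that the point move B3 wins every singular
axis germ of order `d` with `δ < 2`, the germ `g` is won.

**Proof (Hironaka's `δ` with one free variable).**  Every monomial `x'^a z^e` of `g` with `|a| < d` has
`e > d - |a|` (`AxisCone`, order `d`), so `stub_axisWeightedMoveLevel` provides `m ≥ 1`, `p ∤ m`, with
`m ≤ δ(g) < m + 2`.  Play `(X, w)`, `w = (m, …, m, 1)` (`isMove`); a singular successor `G` sits at `c = (c', c_z) ≠ 0`
with `g(chart w c) = s^{md} · G` (`weightedOrder_eq`, `CobordantChart.eq_weightedOrder_of_factor`).  Every slot is tame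
(`p ∤ m`, `p ∤ 1`), so at a slot `i` with `c_i ≠ 0` the successor is `u · Φ(cyl Sl)` over its slice `Sl = G|_{y_i = 0}`
(`tameSlice`) and is won as soon as `Sl` is (`won_cyl`, `won_subst_iff`, `won_unit_mul_iff`), with `ord Sl ≤ ord G`.
* `c' ≠ 0`: `ord G < d` (`order_lt_of_ne_zero`: for `c_z = 0` the translate `F(c' + y')` would be `F` against
  `TrivialApexX`; for `c_z ≠ 0` the vector `-c'/c_z^m` would solve the level-`m` vertex against `PreparedAxis`),
  so `ord Sl < d` and `Sl` is won by hypothesis (or outright if non-singular).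
* `c' = 0` (the axis point, `c_z ≠ 0`), slice at the `z`-slot: if `δ(g) < m + 1`, `ord Sl < d` (`order_slice_lt`);
  if `δ(g) ≥ m + 1` and the level-`(m+1)` line is non-empty (`δ = m + 1 ∈ ℕ`, `p ∣ δ`), `Sl` has order `d` and an
  apex-free tangent cone (`apexFree_slice`), won by `TangentConeCut.apexFreeStartsWon`; if the line is empty
  (`δ ∉ ℕ`), the rotated slice is an axis germ with `δ(S) = δ - m < 2`, won by B3 (`won_slice_of_lineEmpty`).
-/

set_option linter.dupNamespace false -- mandated namespace of this single-conjunct summit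

namespace Summit.ResolutionOfSingularities.ResolutionOfSingularities.Theorems

open Literature.AlgebraicGeometry.Resolution

open AxisWeightedMove in
/-- THE WEIGHTED MOVE FROM A PREPARED AXIS GERM, stub `stub_axisWeightedMove` (B2) of the line
`hasse-ridge-face-selection` of crux `LocalWeightedDrop` (stmt-ResolutionOfSingularities-8899): given the point move
(B3) for the same `(p, k, n, d)` and the singular germs of smaller order, a singular `g` of order `d` with `AxisCone`,
`TrivialApexX`, `¬ InAxisIdeal` and `PreparedAxis` is won — by the move `(X, (m, …, m, 1))` with `m = ⌊δ⌋` if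
`p ∤ ⌊δ⌋` else `⌊δ⌋ - 1` (`stub_axisWeightedMoveLevel`): off the axis point the order of the successor drops
(`AxisWeightedMove.order_lt_of_ne_zero`); at the axis point the `z`-slot slice drops (`δ < m + 1`), is apex-free
(`δ = m + 1`, `TangentConeCut.apexFreeStartsWon`), or is again an axis germ with `δ < 2` after rotating the variables
(`δ ∉ ℕ`, B3). -/
theorem stub_axisWeightedMove : ∀ (p : ℕ), p.Prime → ∀ (k : Type) [Field k] [CharP k p] [IsAlgClosed k] (n d : ℕ)
    (g : MvPowerSeries (Fin (n + 1)) k), CobordantGame.IsSingular k g → g.order = d →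
    AxisPolyhedron.AxisCone d g → AxisPolyhedron.TrivialApexX d g → ¬ AxisPolyhedron.InAxisIdeal d g →
    AxisPolyhedron.PreparedAxis d g →
    (∀ h : MvPowerSeries (Fin (n + 1)) k, CobordantGame.IsSingular k h → h.order < g.order →
      CobordantGame.Won k (n + 1) h) →
    (∀ S : MvPowerSeries (Fin (n + 1)) k, CobordantGame.IsSingular k S → S.order = d →
      AxisPolyhedron.AxisCone d S → AxisPolyhedron.TrivialApexX d S → ¬ AxisPolyhedron.AboveLevel d 2 1 S →
      (∀ h : MvPowerSeries (Fin (n + 1)) k, CobordantGame.IsSingular k h → h.order < S.order →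
        CobordantGame.Won k (n + 1) h) →
      CobordantGame.Won k (n + 1) S) →
    CobordantGame.Won k (n + 1) g := by
  intro p hp k _ _ _ n d g hg hgd hcone hapex hnin hprep hord hB3
  -- `d ≥ 2`
  have hd2 : 2 ≤ d := by
    have h := (FormalCoordChange.two_le_order_iff g).mpr hg.2
    rw [hgd] at h
    exact_mod_cast h
  have hordd : ∀ h : MvPowerSeries (Fin (n + 1)) k, CobordantGame.IsSingular k h → h.order < (d : ℕ∞) →
      CobordantGame.Won k (n + 1) h := fun h hh hlt => hord h hh (by rw [hgd]; exact hlt)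
  -- THE LEVEL `m`: every monomial `x'^a z^e` with `|a| < d` has `e > d - |a|`
  have hex : ∃ E : Fin (n + 1) →₀ ℕ, AxisPolyhedron.xDeg E < d ∧ MvPowerSeries.coeff E g ≠ 0 := by
    by_contra h
    push Not at h
    exact hnin h
  have hgt : ∀ E : Fin (n + 1) →₀ ℕ, AxisPolyhedron.xDeg E < d → MvPowerSeries.coeff E g ≠ 0 →
      d - AxisPolyhedron.xDeg E < E (Fin.last n) := by
    intro E hEx hEg
    by_contra hle
    push Not at hle
    have hdE : d ≤ E.degree := by
      by_contra hlt
      push Not at hlt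
      exact hEg (MvPowerSeries.coeff_of_lt_order (by rw [hgd]; exact_mod_cast hlt))
    rw [AxisMove.degree_eq_xDeg_add] at hdE
    have hdeg : E.degree = d := by
      rw [AxisMove.degree_eq_xDeg_add]
      omega
    exact hEg (hcone E hdeg (by omega))
  obtain ⟨m, hm1, hpm, hlevm, E₀, hE₀x, hE₀g, hE₀z⟩ := stub_axisWeightedMoveLevel p hp k n d g hex hgt
  have hlev : AxisPolyhedron.AboveLevel d m 1 g := by
    intro E hEx hlt
    by_contra hne
    have h := hlevm E hEx hne
    omega
  -- THE WEIGHTS `(m, …, m, 1)` AND THE MOVE `(X, w)`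
  set w : Fin (n + 1) → ℕ := fun i => if i = Fin.last n then 1 else m with hw
  have hw1 : w (Fin.last n) = 1 := if_pos rfl
  have hwm : ∀ j, w (Fin.castSucc j) = m := fun j => if_neg (Fin.castSucc_ne_last j)
  have hpw : ∀ i, ¬ p ∣ w i := by
    intro i
    rcases Fin.eq_castSucc_or_eq_last i with ⟨j, rfl⟩ | rfl
    · rw [hwm]; exact hpm
    · rw [hw1]; exact fun h => hp.one_lt.ne' (Nat.dvd_one.mp h)
  refine CobordantGame.Won.move MvPowerSeries.X w (isMove w hw1) fun G hG => ?_
  obtain ⟨c, a, ⟨i₀, -, hci₀⟩, hfac, hndvd, -⟩ := hG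
  -- the crux's chart is `chart w c` (all weights positive), and `subst X g = g`
  have hconv : ∀ i, w i = 0 → c i = 0 := fun i hi => absurd hi (weight_pos hw1 hwm hm1 i).ne'
  have hcf : (fun i => if 0 < w i then c i else 0) = c := funext fun i => if_pos (weight_pos hw1 hwm hm1 i)
  have hchart : CobordantGame.cruxChart k w c = CobordantChart.chart w c := by
    have h := CobordantChart.cruxChart_eq_chart (k := k) w c
    rw [hcf] at h
    exact h
  have hself : MvPowerSeries.subst (MvPowerSeries.X : Fin (n + 1) → MvPowerSeries (Fin (n + 1)) k) g = g := by
    rw [MvPowerSeries.subst_self]; rfl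
  rw [hchart, hself] at hfac
  -- `a = m d`
  have had : a = m * d := by
    have h : (a : ℕ∞) = g.weightedOrder w :=
      CobordantChart.eq_weightedOrder_of_factor w c hconv hg.1 hfac hndvd
    rw [weightedOrder_eq hw1 hwm hlev hcone hgd hg.1] at h
    exact_mod_cast h
  rw [had] at hfac
  -- THE SLICING STEP: every slot is tame; `G = u · Φ(cyl Sl)` is won with its slice `Sl`, and `ord Sl ≤ ord G`
  have key : ∀ i₁ : Fin (n + 1), c i₁ ≠ 0 →
      ((MvPowerSeries.subst (fun j : Fin (n + 2) => if j = i₁.succ then (0 : MvPowerSeries (Fin (n + 1)) k)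
          else MvPowerSeries.X (Fin.predAbove i₁ j)) G).order ≤ G.order →
        CobordantGame.Won k (n + 1) (MvPowerSeries.subst (fun j : Fin (n + 2) => if j = i₁.succ then
          (0 : MvPowerSeries (Fin (n + 1)) k) else MvPowerSeries.X (Fin.predAbove i₁ j)) G)) →
      CobordantGame.Won k (n + 2) G := by
    intro i₁ hci₁ hwin
    obtain ⟨Φ₂, u, hΦ0, hΦdet, hu, hGu⟩ :=
      tameSlice p hp k (n + 1) g w c hconv (m * d) G hfac i₁ hci₁ (hpw i₁)
    set Sl : MvPowerSeries (Fin (n + 1)) k := MvPowerSeries.subst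
      (fun j : Fin (n + 2) => if j = i₁.succ then (0 : MvPowerSeries (Fin (n + 1)) k)
        else MvPowerSeries.X (Fin.predAbove i₁ j)) G with hSl
    have hle : Sl.order ≤ G.order := by
      have h : Sl.order ≤ (u * MvPowerSeries.subst Φ₂ (MvPowerSeries.subst
          (fun m : Fin (n + 1) => (MvPowerSeries.X ((Fin.succ i₁).succAbove m) : MvPowerSeries (Fin (n + 2)) k))
          Sl)).order := by
        refine le_trans ?_ MvPowerSeries.le_order_mul
        refine le_trans ?_ le_add_self
        refine le_trans ?_ (ApexFreeOrderDrop.order_le_order_subst hΦ0 _)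
        exact ApexFreeOrderDrop.order_le_order_subst (fun m => MvPowerSeries.constantCoeff_X _) _
      rw [← hGu] at h
      exact h
    have hWSl : CobordantGame.Won k (n + 1) Sl := hwin hle
    rw [hGu]
    exact (won_unit_mul_iff hu _).mpr ((won_subst_iff hΦ0 hΦdet _).mpr (won_cyl i₁.succ hWSl))
  -- a slice of order `< d` is won (by hypothesis if singular, outright if not)
  have hdrop : ∀ Sl : MvPowerSeries (Fin (n + 1)) k, Sl.order < (d : ℕ∞) → CobordantGame.Won k (n + 1) Sl := by
    intro Sl hlt
    by_cases hSs : CobordantGame.IsSingular k Sl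
    · exact hordd Sl hSs hlt
    · exact (wonBy_zero_of_not_isSingular (Nat.succ_pos n) hSs).won
  by_cases hc' : ∃ j : Fin n, c (Fin.castSucc j) ≠ 0
  · -- (i) OFF THE AXIS POINT (`c' ≠ 0`): the order of the successor drops
    obtain ⟨j, hj⟩ := hc'
    have hGlt : G.order < (d : ℕ∞) := order_lt_of_ne_zero hw1 hwm hm1 hfac hcone hapex hlev hprep ⟨j, hj⟩
    exact key (Fin.castSucc j) hj fun hle => hdrop _ (lt_of_le_of_lt hle hGlt)
  · -- (ii) THE AXIS POINT `c = (0, c_z)`: slice at the `z`-slot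
    push Not at hc'
    have hcz : c (Fin.last n) ≠ 0 := by
      rcases Fin.eq_castSucc_or_eq_last i₀ with ⟨j, rfl⟩ | rfl
      · exact absurd (hc' j) hci₀
      · exact hci₀
    refine key (Fin.last n) hcz fun _ => ?_
    by_cases hlev1 : AxisPolyhedron.AboveLevel d (m + 1) 1 g
    · have hSlord := order_slice_eq hw1 hwm hm1 hfac hc' hlev1 hcone hgd hg.1
      by_cases hline : ∃ E : Fin (n + 1) →₀ ℕ, AxisPolyhedron.xDeg E < d ∧
          E (Fin.last n) = (m + 1) * (d - AxisPolyhedron.xDeg E) ∧ MvPowerSeries.coeff E g ≠ 0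
      · -- `δ = m + 1`: apex-free slice
        exact TangentConeCut.apexFreeStartsWon p hp k (Nat.succ_pos n) _ d hSlord
          (fun h hh hlt => hordd h hh (by rw [hSlord] at hlt; exact hlt))
          (apexFree_slice hw1 hwm hm1 hfac hc' hcz hlev1 hcone hapex hprep hline)
      · -- `m + 1 < δ < m + 2`: the rotated slice is an axis germ with `δ < 2`, won by B3
        push Not at hline
        exact won_slice_of_lineEmpty hw1 hwm hm1 hfac hc' hcz hlev hlev1 hline
          hcone hapex hgd hg.1 hd2 hE₀x hE₀g hE₀z hB3 hordd
    · -- `δ < m + 1`: the slice drops below `d`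
      obtain ⟨E₁, hE₁x, hE₁z, hE₁g⟩ : ∃ E : Fin (n + 1) →₀ ℕ, AxisPolyhedron.xDeg E < d ∧
          1 * E (Fin.last n) < (m + 1) * (d - AxisPolyhedron.xDeg E) ∧ MvPowerSeries.coeff E g ≠ 0 := by
        by_contra hno
        push Not at hno
        exact hlev1 hno
      rw [one_mul] at hE₁z
      exact hdrop _ (order_slice_lt hw1 hwm hm1 hfac hc' hcz hlev hE₁x hE₁g hE₁z)

end Summit.ResolutionOfSingularities.ResolutionOfSingularities.Theorems
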